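import Summits.HodgeConjecture.HodgeConjecture.Theorems.F0P3cStCharTSJacCartanWindow       -- ★-cand (C8b-window): product window, slices, quotient mass (brings ★ C1–C5, C8a, C8b-core, C8b-product, Q1)
import HarnessLib

/-!
# F0 · P3c · line LH6 «StCharTS» — WIF antecedent, ELLIPTIC half: brick (C8b-tube) «THE TUBE OVER A COSET WINDOW»

Cell `pub/hodgecm-mathlib`, crux H413 = `stmt-HodgeConjecture-24833` (lane `--supports … --as helper`); seat LH5-p02 (g6); ROAD «JAC-ELL» v1 §2 steps (3)–(4), (7),
in ★ (C4)'s ABSTRACT frame + complementary projections `pM + pT = id` + a subgroup `T ≤ G` linked to `ker pM` through the chart + an element `t₀ ∈ T` with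
`ρ t₀`, `ρ t₀⁻¹` integral + the linear part `L` and tube map `Θ` of ★ (C8b-core).  THEOREMS ONLY; Mathlib + ★ (C1)–(C5), (C8a), (C8b-core∕product∕window).

* §1 `tube_image_eq` — the tube over the coset window: `Φ(π c(Λ′_k) × {t | t ∈ t₀·c(Y + Λ_j)}) = t₀ · c(Θ(A))`, `A = {Z ∈ Λ′_k | pT Z ∈ Y + Λ_j}`;
  `exists_param` — its parametrisation `(q, t) = (π c(pM Z), t₀ c(pT Z))`, `Φ(q, t) = t₀ c(Θ Z)` (chart injectivity of the tube follows).
* §2 `isOpen_image_twisted` — `Θ(A)` is open (a union of `L(Λ′_j)`-cosets, ★ C1); `cosetWindow_nested_or_disjoint` — the coset windows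
  `{t | t ∈ t₀·c(Y + Λ_j)}` (`Y ∈ Λ_k`, `j ≥ k`) are pairwise nested or disjoint.

Purpose: consumed by ★-cand `F0P3cStCharTSJacCartanSocketCore` (the abstract (E1b) socket) and the model instantiation `F0P3cStCharTSJacCartanElliptic`.
HONEST LABEL: count-neutral; closes no organ; HC_CM is proved only modulo the printed citations (h413 = `stmt-HodgeConjecture-24833`) until rung 0 closes.

## References
* [HarishChandra1970] Harish-Chandra (notes by G. van Dijk), *Harmonic Analysis on Reductive p-adic Groups*, LNM 162 (1970), Lemma 22. Context locator.
* [Serre1992LALG] J.-P. Serre, *Lie Algebras and Lie Groups*, LNM 1500 (1992), Part II Ch. IV §8–§9. Context locator.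
* [DeitmarEchterhoff2014] A. Deitmar, S. Echterhoff, *Principles of Harmonic Analysis*, 2nd ed., Thm. 1.5.3. Context locator.
* [Rogawski1990] J. D. Rogawski, *Automorphic Representations of Unitary Groups in Three Variables* (1990), §12.5 p. 182 (Weyl integration formula). Context locator.
-/

set_option autoImplicit false
set_option linter.dupNamespace false

open Set Filter MeasureTheory MeasureTheory.Measure TopologicalSpace Topology Matrix ValuativeRel
open Literature.NumberTheory.Automorphic Literature.NumberTheory.Weil1982.UnitaryFinTopForm Literature.MeasureTheory.Group
open Summit.HodgeConjecture.HodgeConjecture.Cruxes.H413.F0P3cStCharTSCayleyChartHaar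
open Summit.HodgeConjecture.HodgeConjecture.Cruxes.H413.F0P3cStCharTSFilteredNewton
open Summit.HodgeConjecture.HodgeConjecture.Cruxes.H413.F0P3cStCharTSFilteredNewtonHaar
open Summit.HodgeConjecture.HodgeConjecture.Cruxes.H413.F0P3cStCharTSNewtonChartHaar
open Summit.HodgeConjecture.HodgeConjecture.Cruxes.H413.F0P3cStCharTSTwistedTubeCore
open Summit.HodgeConjecture.HodgeConjecture.Cruxes.H413.F0P3cStCharTSJacCartanProduct
open Summit.HodgeConjecture.HodgeConjecture.Cruxes.H413.F0P3cStCharTSJacCartanWindow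
open scoped Pointwise Topology ENNReal NNReal MatrixGroups

namespace Summit.HodgeConjecture.HodgeConjecture.Cruxes.H413.F0P3cStCharTSJacCartanTube

variable {K : Type*} [Field K] [ValuativeRel K] [TopologicalSpace K] [IsNonarchimedeanLocalField K]
  {m : Type*} [Fintype m] [DecidableEq m]
  {V : Type*} [AddCommGroup V] [TopologicalSpace V] [IsTopologicalAddGroup V] [T2Space V]
  {G : Type*} [Group G] [TopologicalSpace G] [IsTopologicalGroup G]
  (ι : V →+ Matrix m m K) (Λ : ℕ → AddSubgroup V) {α : ValueGroupWithZero K} (ρ : G →* GL m K) (c : V → G) (σV : V → V → V)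
  (pM pT : V →+ V) {Λ' : ℕ → AddSubgroup V} (L : V ≃ₜ+ V) (Θ Ξ : V → V) (T : Subgroup G) {t₀ : G} {k : ℕ}

/-! ## §1 The tube over a coset window -/

omit [TopologicalSpace G] [IsTopologicalGroup G] in
/-- **THE TUBE OVER THE COSET WINDOW**: `Φ(π c(Λ′_k) × {t ∈ T | t ∈ t₀·c(Y + Λ_j)}) = t₀ · c(Θ{Z ∈ Λ′_k | pT Z ∈ Y + Λ_j})` (★ C8b-core tube identity).
[cite: HarishChandra1970, Lemma 22] -/
theorem tube_image_eq (hι : IsClosedEmbedding ι) (hΛ : ∀ j X, X ∈ Λ j ↔ ValBound (α ^ (j + 1)) (ι X)) (hα : α ≠ 0) (hα1 : α < 1)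
    (hρinj : Function.Injective ρ) (hc : ∀ X ∈ Λ 0, ((ρ (c X) : GL m K) : Matrix m m K) = cayley (ι X))
    (hΛ' : ∀ j Z, Z ∈ Λ' j ↔ (pM Z ∈ Λ j ∧ pT Z ∈ Λ j)) (hsum : ∀ Z, pM Z + pT Z = Z) (hidem : ∀ Z, pM (pM Z) = pM Z)
    (hpMc : Continuous pM) (hpTc : Continuous pT) (hshift : ∀ j, ∀ Z ∈ Λ (j + k), pM Z ∈ Λ j ∧ pT Z ∈ Λ j)
    (hΞ : ∀ Z ∈ Λ' k, ι (Ξ Z) = (1 - ι (pM Z))⁻¹ * (ι (pM Z) + ι (pT Z)) * (1 + ι (pM Z) * ι (pT Z))⁻¹ * (1 - ι (pM Z)))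
    (hcT : ∀ Y ∈ Λ 0, pM Y = 0 → c Y ∈ T) (hTc : ∀ W ∈ Λ 0, c W ∈ T → pM W = 0) (ht₀ : t₀ ∈ T)
    (hT1 : ValBound 1 ((ρ t₀ : GL m K) : Matrix m m K)) (hTinv1 : ValBound 1 (((ρ t₀)⁻¹ : GL m K) : Matrix m m K))
    (hΘ : ∀ Z ∈ Λ' k, ι (Θ Z) =
      (fun W X : Matrix m m K => (1 - W)⁻¹ * (W + X) * (1 + W * X)⁻¹ * (1 - W)) ((((ρ t₀)⁻¹ : GL m K) : Matrix m m K) * ι (pM Z) * ((ρ t₀ : GL m K) : Matrix m m K))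
        ((fun W X : Matrix m m K => (1 - W)⁻¹ * (W + X) * (1 + W * X)⁻¹ * (1 - W)) (ι (pT Z)) (-ι (pM Z))))
    (Φ : (G ⧸ T) × ↥T → G) (hΦ : ∀ (x : G) (t : ↥T), Φ (QuotientGroup.mk x, t) = x * t * x⁻¹)
    {j : ℕ} (hj : k ≤ j) {Y : V} (hY : Y ∈ Λ k) :
    Φ '' (((QuotientGroup.mk : G → G ⧸ T) '' (c '' (Λ' k : Set V))) ×ˢ {t : ↥T | (t : G) ∈ t₀ • c '' (Y +ᵥ (Λ j : Set V))}) =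
      t₀ • c '' (Θ '' ((Λ' k : Set V) ∩ pT ⁻¹' (Y +ᵥ (Λ j : Set V)))) := by
  have hanti := level_antitone ι Λ hΛ hα1.le
  have hk0 : Λ k ≤ Λ 0 := hanti (Nat.zero_le k)
  have hjk : Λ j ≤ Λ k := hanti hj
  have hP := proj_ids pM pT hsum hidem
  have hΞmem : ∀ Z ∈ Λ' k, Ξ Z ∈ Λ 0 := fun Z hZ => hk0 (product_mem_level ι Λ pM pT Ξ hΛ hα1 hΛ' hΞ hZ)
  have hΞc : ∀ Z ∈ Λ' k, c (Ξ Z) = c (pM Z) * c (pT Z) := fun Z hZ => chart_product ι Λ ρ c pM pT Ξ hΛ hα1 hρinj hc hΛ' hΞ hΞmem hZ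
  have himg := image_product_subBox ι Λ pM pT Ξ hι hΛ hα hα1 hΛ' hsum hpMc hpTc hshift hΞ
  have htube : ∀ Z ∈ Λ' k, c (pM Z) * t₀ * c (pT Z) * (c (pM Z))⁻¹ = t₀ * c (Θ Z) := fun Z hZ =>
    tube_eq_mul_chart_twisted ι Λ ρ c pM pT Θ t₀ hΛ hα1 hρinj hc hΛ' hT1 hTinv1 hΘ hZ
  -- cosets `Y + Λ j ⊆ Λ k`
  have hYcos : Y +ᵥ (Λ j : Set V) ⊆ (Λ k : Set V) := by
    rintro _ ⟨y, hy, rfl⟩; exact add_mem hY (hjk hy)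
  apply Subset.antisymm
  · rintro _ ⟨⟨q, t⟩, ⟨hq, ht⟩, rfl⟩
    obtain ⟨_, ⟨Z₀, hZ₀, rfl⟩, rfl⟩ := hq
    have hZ₀' : Z₀ ∈ Ξ '' (Λ' k : Set V) := by rw [himg]; exact hZ₀
    obtain ⟨Z₁, hZ₁, rfl⟩ := hZ₀'
    obtain ⟨hZ₁M, hZ₁T⟩ := (hΛ' k Z₁).1 hZ₁
    obtain ⟨_, ⟨W, hW, rfl⟩, htW⟩ := ht
    have htW' : t₀ * c W = (t : G) := htW
    have hWk : W ∈ Λ k := hYcos hW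
    have hcWT : c W ∈ T := by
      have : c W = t₀⁻¹ * (t : G) := by rw [← htW', inv_mul_cancel_left]
      rw [this]; exact T.mul_mem (T.inv_mem ht₀) t.2
    have hW0 : pM W = 0 := hTc W (hk0 hWk) hcWT
    set Z := pM Z₁ + W with hZdef
    have hZM : pM Z = pM Z₁ := by rw [hZdef, map_add, hidem, hW0, add_zero]
    have hZT : pT Z = W := by rw [hZdef, map_add, (hP Z₁).2.2.1, zero_add, (hP W).2.2.2.2 hW0]
    have hZ : Z ∈ Λ' k := (hΛ' k Z).2 ⟨by rw [hZM]; exact hZ₁M, by rw [hZT]; exact hWk⟩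
    have hZA : Z ∈ (Λ' k : Set V) ∩ pT ⁻¹' (Y +ᵥ (Λ j : Set V)) := ⟨hZ, by show pT Z ∈ Y +ᵥ (Λ j : Set V); rw [hZT]; exact hW⟩
    refine ⟨c (Θ Z), ⟨Θ Z, ⟨Z, hZA, rfl⟩, rfl⟩, ?_⟩
    show t₀ • c (Θ Z) = Φ (QuotientGroup.mk (c (Ξ Z₁)), t)
    rw [hΞc Z₁ hZ₁, QuotientGroup.mk_mul_of_mem _ (hcT _ (hk0 hZ₁T) (hP Z₁).2.1), hΦ, ← htW', smul_eq_mul, ← htube Z hZ, hZM, hZT, ← mul_assoc]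
  · rintro _ ⟨_, ⟨_, ⟨Z, ⟨hZ, hZY⟩, rfl⟩, rfl⟩, rfl⟩
    have hZY' : pT Z ∈ Y +ᵥ (Λ j : Set V) := hZY
    obtain ⟨hZM, hZT⟩ := (hΛ' k Z).1 hZ
    have hMk : pM Z ∈ Λ' k := (hΛ' k _).2 ⟨by rw [hidem]; exact hZM, by rw [(hP Z).2.2.1]; exact zero_mem _⟩
    have hΞM : c (Ξ (pM Z)) = c (pM Z) := by rw [hΞc _ hMk, hidem, (hP Z).2.2.1, chart_zero ι Λ ρ c hρinj hc, mul_one]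
    have hq : QuotientGroup.mk (c (pM Z)) ∈ (QuotientGroup.mk : G → G ⧸ T) '' (c '' (Λ' k : Set V)) := by
      refine ⟨c (Ξ (pM Z)), ⟨Ξ (pM Z), ?_, rfl⟩, by rw [hΞM]⟩
      rw [← himg]; exact ⟨pM Z, hMk, rfl⟩
    have htT : t₀ * c (pT Z) ∈ T := T.mul_mem ht₀ (hcT _ (hk0 hZT) (hP Z).2.1)
    refine ⟨(QuotientGroup.mk (c (pM Z)), ⟨t₀ * c (pT Z), htT⟩), ⟨hq, ?_⟩, ?_⟩
    · show t₀ * c (pT Z) ∈ t₀ • c '' (Y +ᵥ (Λ j : Set V))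
      exact ⟨c (pT Z), ⟨pT Z, hZY', rfl⟩, rfl⟩
    · show Φ (QuotientGroup.mk (c (pM Z)), ⟨t₀ * c (pT Z), htT⟩) = t₀ • c (Θ Z)
      rw [hΦ, smul_eq_mul, ← htube Z hZ, ← mul_assoc]

/-! ## §2 The image `Θ(A)` is open -/

omit [TopologicalSpace G] [IsTopologicalGroup G] in
/-- **`Θ(A)` is open** for `A = {Z ∈ Λ′_k | pT Z ∈ Y + Λ_j}`, `j ≥ k`: `A` is a union of `Λ′_j`-cosets and `Θ` maps `Z + Λ′_j` onto `Θ Z + L(Λ′_j)` (★ C1).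
[cite: Serre1992LALG, Part II Ch. IV §8] -/
theorem isOpen_image_twisted (hι : IsClosedEmbedding ι) (hΛ : ∀ j X, X ∈ Λ j ↔ ValBound (α ^ (j + 1)) (ι X)) (hα : α ≠ 0) (hα1 : α < 1)
    (hΛ' : ∀ j Z, Z ∈ Λ' j ↔ (pM Z ∈ Λ j ∧ pT Z ∈ Λ j)) (hsum : ∀ Z, pM Z + pT Z = Z)
    (hpMc : Continuous pM) (hpTc : Continuous pT) (hshift : ∀ j, ∀ Z ∈ Λ (j + k), pM Z ∈ Λ j ∧ pT Z ∈ Λ j)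
    {Tm Tinv : Matrix m m K} (hT1 : ValBound 1 Tm) (hTinv1 : ValBound 1 Tinv)
    (hL : ∀ Z, ι (L Z) = Tinv * ι (pM Z) * Tm - ι (pM Z) + ι (pT Z))
    (hΘ : ∀ Z ∈ Λ' k, ι (Θ Z) =
      (fun W X : Matrix m m K => (1 - W)⁻¹ * (W + X) * (1 + W * X)⁻¹ * (1 - W)) (Tinv * ι (pM Z) * Tm)
        ((fun W X : Matrix m m K => (1 - W)⁻¹ * (W + X) * (1 + W * X)⁻¹ * (1 - W)) (ι (pT Z)) (-ι (pM Z))))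
    (hshiftL : ∀ j, ∀ Z ∈ Λ (j + k), pM (L.symm Z) ∈ Λ j ∧ pT (L.symm Z) ∈ Λ j)
    {j : ℕ} (hj : k ≤ j) (Y : V) : IsOpen (Θ '' ((Λ' k : Set V) ∩ pT ⁻¹' (Y +ᵥ (Λ j : Set V)))) := by
  have hanti := level_antitone ι Λ hΛ hα1.le
  have hanti' : Antitone Λ' := subBox_antitone hΛ' hanti
  have hopenΛ := isOpen_level ι Λ hι.continuous hΛ hα
  have hopen' := isOpen_subBox hΛ' hopenΛ hshift
  set A := (Λ' k : Set V) ∩ pT ⁻¹' (Y +ᵥ (Λ j : Set V)) with hA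
  have hcos : ∀ Z ∈ A, Z +ᵥ (Λ' j : Set V) ⊆ A := by
    rintro Z ⟨hZk, hZj⟩ _ ⟨y, hy, rfl⟩
    refine ⟨add_mem hZk (hanti' hj hy), ?_⟩
    obtain ⟨w, hw, hwZ⟩ := (hZj : pT Z ∈ Y +ᵥ (Λ j : Set V))
    have hwZ' : Y + w = pT Z := hwZ
    show pT (Z + y) ∈ Y +ᵥ (Λ j : Set V)
    refine ⟨w + pT y, add_mem hw ((hΛ' j y).1 hy).2, ?_⟩
    show Y + (w + pT y) = pT (Z + y)
    rw [map_add, ← hwZ', add_assoc]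
  have hunion : Θ '' A = ⋃ Z ∈ A, Θ '' (Z +ᵥ (Λ' j : Set V)) := by
    apply Subset.antisymm
    · rintro _ ⟨Z, hZ, rfl⟩
      exact mem_iUnion₂.2 ⟨Z, hZ, ⟨Z, ⟨0, zero_mem _, by simp⟩, rfl⟩⟩
    · exact iUnion₂_subset fun Z hZ => image_mono (hcos Z hZ)
  rw [hunion]
  refine isOpen_biUnion fun Z hZ => ?_
  rw [image_vadd_eq_of_linearNewton Λ' Θ L hanti' hopen' (isCompact_subBox hΛ' hopenΛ (isCompact_level ι Λ hι hΛ) hshift hsum k)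
    (subBox_basis hΛ' hsum (exists_level_subset_of_mem_nhds ι Λ hι hΛ hα1)) (continuousOn_twisted ι Λ pM pT hι hΛ hα1 hΛ' hpMc hpTc hT1 hTinv1 Θ hΘ)
    (twisted_newton ι Λ pM pT L Θ hΛ hα1 hΛ' hT1 hTinv1 hL hΘ hshiftL) hj hZ.1]
  exact (L.toHomeomorph.isOpenMap _ (hopen' j)).vadd _

omit [TopologicalSpace G] [IsTopologicalGroup G] in
/-- **Parametrisation of the tube over a coset window**: every `(q, t) ∈ π c(Λ′_k) × {t | t ∈ t₀·c(Y + Λ_j)}` is `(π c(pM Z), t₀ c(pT Z))` for some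
`Z ∈ Λ′_k` with `pT Z ∈ Y + Λ_j`, and then `Φ(q, t) = t₀ · c(Θ Z)`. [cite: HarishChandra1970, Lemma 22] -/
theorem exists_param (hι : IsClosedEmbedding ι) (hΛ : ∀ j X, X ∈ Λ j ↔ ValBound (α ^ (j + 1)) (ι X)) (hα : α ≠ 0) (hα1 : α < 1)
    (hρinj : Function.Injective ρ) (hc : ∀ X ∈ Λ 0, ((ρ (c X) : GL m K) : Matrix m m K) = cayley (ι X))
    (hΛ' : ∀ j Z, Z ∈ Λ' j ↔ (pM Z ∈ Λ j ∧ pT Z ∈ Λ j)) (hsum : ∀ Z, pM Z + pT Z = Z) (hidem : ∀ Z, pM (pM Z) = pM Z)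
    (hpMc : Continuous pM) (hpTc : Continuous pT) (hshift : ∀ j, ∀ Z ∈ Λ (j + k), pM Z ∈ Λ j ∧ pT Z ∈ Λ j)
    (hΞ : ∀ Z ∈ Λ' k, ι (Ξ Z) = (1 - ι (pM Z))⁻¹ * (ι (pM Z) + ι (pT Z)) * (1 + ι (pM Z) * ι (pT Z))⁻¹ * (1 - ι (pM Z)))
    (hcT : ∀ Y ∈ Λ 0, pM Y = 0 → c Y ∈ T) (hTc : ∀ W ∈ Λ 0, c W ∈ T → pM W = 0) (ht₀ : t₀ ∈ T)
    (hT1 : ValBound 1 ((ρ t₀ : GL m K) : Matrix m m K)) (hTinv1 : ValBound 1 (((ρ t₀)⁻¹ : GL m K) : Matrix m m K))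
    (hΘ : ∀ Z ∈ Λ' k, ι (Θ Z) =
      (fun W X : Matrix m m K => (1 - W)⁻¹ * (W + X) * (1 + W * X)⁻¹ * (1 - W)) ((((ρ t₀)⁻¹ : GL m K) : Matrix m m K) * ι (pM Z) * ((ρ t₀ : GL m K) : Matrix m m K))
        ((fun W X : Matrix m m K => (1 - W)⁻¹ * (W + X) * (1 + W * X)⁻¹ * (1 - W)) (ι (pT Z)) (-ι (pM Z))))
    (Φ : (G ⧸ T) × ↥T → G) (hΦ : ∀ (x : G) (t : ↥T), Φ (QuotientGroup.mk x, t) = x * t * x⁻¹)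
    {j : ℕ} (hj : k ≤ j) {Y : V} (hY : Y ∈ Λ k) {q : G ⧸ T} {t : ↥T}
    (hq : q ∈ (QuotientGroup.mk : G → G ⧸ T) '' (c '' (Λ' k : Set V))) (ht : (t : G) ∈ t₀ • c '' (Y +ᵥ (Λ j : Set V))) :
    ∃ Z ∈ (Λ' k : Set V) ∩ pT ⁻¹' (Y +ᵥ (Λ j : Set V)), q = QuotientGroup.mk (c (pM Z)) ∧ (t : G) = t₀ * c (pT Z) ∧ Φ (q, t) = t₀ * c (Θ Z) := by
  have hanti := level_antitone ι Λ hΛ hα1.le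
  have hk0 : Λ k ≤ Λ 0 := hanti (Nat.zero_le k)
  have hjk : Λ j ≤ Λ k := hanti hj
  have hP := proj_ids pM pT hsum hidem
  have hΞmem : ∀ Z ∈ Λ' k, Ξ Z ∈ Λ 0 := fun Z hZ => hk0 (product_mem_level ι Λ pM pT Ξ hΛ hα1 hΛ' hΞ hZ)
  have hΞc : ∀ Z ∈ Λ' k, c (Ξ Z) = c (pM Z) * c (pT Z) := fun Z hZ => chart_product ι Λ ρ c pM pT Ξ hΛ hα1 hρinj hc hΛ' hΞ hΞmem hZ
  have himg := image_product_subBox ι Λ pM pT Ξ hι hΛ hα hα1 hΛ' hsum hpMc hpTc hshift hΞ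
  obtain ⟨_, ⟨Z₀, hZ₀, rfl⟩, rfl⟩ := hq
  have hZ₀' : Z₀ ∈ Ξ '' (Λ' k : Set V) := by rw [himg]; exact hZ₀
  obtain ⟨Z₁, hZ₁, rfl⟩ := hZ₀'
  obtain ⟨hZ₁M, hZ₁T⟩ := (hΛ' k Z₁).1 hZ₁
  obtain ⟨_, ⟨W, hW, rfl⟩, htW⟩ := ht
  have htW' : t₀ * c W = (t : G) := htW
  have hWk : W ∈ Λ k := by obtain ⟨y, hy, rfl⟩ := hW; exact add_mem hY (hjk hy)
  have hcWT : c W ∈ T := by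
    have : c W = t₀⁻¹ * (t : G) := by rw [← htW', inv_mul_cancel_left]
    rw [this]; exact T.mul_mem (T.inv_mem ht₀) t.2
  have hW0 : pM W = 0 := hTc W (hk0 hWk) hcWT
  have hZM : pM (pM Z₁ + W) = pM Z₁ := by rw [map_add, hidem, hW0, add_zero]
  have hZT : pT (pM Z₁ + W) = W := by rw [map_add, (hP Z₁).2.2.1, zero_add, (hP W).2.2.2.2 hW0]
  have hZ : pM Z₁ + W ∈ Λ' k := (hΛ' k _).2 ⟨by rw [hZM]; exact hZ₁M, by rw [hZT]; exact hWk⟩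
  refine ⟨pM Z₁ + W, ⟨hZ, by show pT (pM Z₁ + W) ∈ Y +ᵥ (Λ j : Set V); rw [hZT]; exact hW⟩, ?_, ?_, ?_⟩
  · rw [hZM, hΞc Z₁ hZ₁, QuotientGroup.mk_mul_of_mem _ (hcT _ (hk0 hZ₁T) (hP Z₁).2.1)]
  · rw [hZT, htW']
  · rw [hΞc Z₁ hZ₁, QuotientGroup.mk_mul_of_mem _ (hcT _ (hk0 hZ₁T) (hP Z₁).2.1), hΦ, ← htW',
      ← tube_eq_mul_chart_twisted ι Λ ρ c pM pT Θ t₀ hΛ hα1 hρinj hc hΛ' hT1 hTinv1 hΘ hZ, hZM, hZT, ← mul_assoc]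

omit [TopologicalSpace K] [IsNonarchimedeanLocalField K] [TopologicalSpace V] [IsTopologicalAddGroup V] [T2Space V] [TopologicalSpace G]
  [IsTopologicalGroup G] in
/-- **The coset windows are nested or disjoint** (so are the cosets `Y + Λ_j` in `V`, ★ C1, and `Z ↦ t₀ c Z` is injective on `Λ 0`).
[cite: Serre1992LALG, Part II Ch. IV §9] -/
theorem cosetWindow_nested_or_disjoint (hinj : Function.Injective ι) (hΛ : ∀ j X, X ∈ Λ j ↔ ValBound (α ^ (j + 1)) (ι X)) (hα1 : α < 1) (h2 : (2 : K) ≠ 0)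
    (hc : ∀ X ∈ Λ 0, ((ρ (c X) : GL m K) : Matrix m m K) = cayley (ι X))
    {j j' : ℕ} (hj : k ≤ j) (hj' : k ≤ j') {Y Y' : V} (hY : Y ∈ Λ k) (hY' : Y' ∈ Λ k) :
    {t : ↥T | (t : G) ∈ t₀ • c '' (Y +ᵥ (Λ j : Set V))} ⊆ {t : ↥T | (t : G) ∈ t₀ • c '' (Y' +ᵥ (Λ j' : Set V))} ∨
      {t : ↥T | (t : G) ∈ t₀ • c '' (Y' +ᵥ (Λ j' : Set V))} ⊆ {t : ↥T | (t : G) ∈ t₀ • c '' (Y +ᵥ (Λ j : Set V))} ∨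
      Disjoint {t : ↥T | (t : G) ∈ t₀ • c '' (Y +ᵥ (Λ j : Set V))} {t : ↥T | (t : G) ∈ t₀ • c '' (Y' +ᵥ (Λ j' : Set V))} := by
  have hanti := level_antitone ι Λ hΛ hα1.le
  have hcinj := injOn_chart ι Λ ρ c h2 hinj hΛ hα1 hc
  have hsub : ∀ {i : ℕ} {X : V}, k ≤ i → X ∈ Λ k → X +ᵥ (Λ i : Set V) ⊆ (Λ 0 : Set V) := by
    rintro i X hi hX _ ⟨y, hy, rfl⟩; exact hanti (Nat.zero_le k) (add_mem hX (hanti hi hy))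
  -- monotonicity of `S ↦ {t | t ∈ t₀ • c(S)}`
  have hmono : ∀ {S S' : Set V}, S ⊆ S' → {t : ↥T | (t : G) ∈ t₀ • c '' S} ⊆ {t : ↥T | (t : G) ∈ t₀ • c '' S'} :=
    fun h t ht => smul_set_mono (image_mono h) ht
  by_cases hd : Disjoint (Y +ᵥ (Λ j : Set V)) (Y' +ᵥ (Λ j' : Set V))
  · refine Or.inr (Or.inr (disjoint_left.2 fun t ht ht' => ?_))
    obtain ⟨_, ⟨Z, hZ, rfl⟩, htZ⟩ := ht
    obtain ⟨_, ⟨Z', hZ', rfl⟩, htZ'⟩ := ht'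
    have hZZ : c Z = c Z' := mul_left_cancel (htZ.trans htZ'.symm : t₀ * c Z = t₀ * c Z')
    have := hcinj (hsub hj hY hZ) (hsub hj' hY' hZ') hZZ
    exact disjoint_left.1 hd hZ (this ▸ hZ')
  · obtain ⟨u, hu, hu'⟩ := not_disjoint_iff.1 hd
    rcases le_total j j' with hjj | hjj
    · exact Or.inr (Or.inl (hmono (vadd_coe_subset_vadd_coe_of_mem Λ hanti hjj hu hu')))
    · exact Or.inl (hmono (vadd_coe_subset_vadd_coe_of_mem Λ hanti hjj hu' hu))

end Summit.HodgeConjecture.HodgeConjecture.Cruxes.H413.F0P3cStCharTSJacCartanTube
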